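import Summits.ValiantsHypothesis.ValiantsHypothesis.Theorems.LacunarySymmetroidMatrixDescartesPivotRankOneCriticalWindowsFourFoldAlgebra
import Summits.ValiantsHypothesis.ValiantsHypothesis.Theorems.LacunarySymmetroidMatrixDescartesCensusSecularRolle

/-!
# `MatrixDescartes` census — rank-one `(2,4)₁`, lone letter: THE REQUIRED LONE WEIGHT — strict window, the one-zero lemma,
# and the derivative bookkeeping that feeds `…FourFoldAlgebra`

HONEST FRAMING.  Object-search cell `pub-symmetroid`, seat `val-sym-mdr-p1` (generation 23); helper file `--supports` the crux item
stmt-ValiantsHypothesis-18050 (`Theses.LacunarySymmetroid.MatrixDescartes`, OPEN, on HOLD) with NO closure claim.  Second file of the MOMENT/FOLD reduction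
(memo MOMENT-FOLD.md): it supplies the analytic and bookkeeping lemmas with which `…FourLoneLetter` turns the cubic fold inequality `𝒞_W > 0` into the
`K = 4` fastest-lone-letter law.  No count is proved here; nothing bears on `MatrixDescartes` in its window, `DoorA26`/`DoorA34`, registers, or `VP ≠ VNP`.

CONTENT (def-free).
* §1 `window_of_critical_four` — at any critical point of the four-letter window profile with direction `T > t₀` (letters `i, k` below the pivot,
  `j` the only letter above): `T < tⱼ` and the STRICT window inequality `bⱼ(T+t₀)(tⱼ−T) < a(T−t₀)(tⱼ+T)` (the signed identity of `…CriticalWindows`,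
  four-letter instance). [folklore]
* §2 `sign_near_zero_of_hasDerivAt_neg`, `eq_of_zeros_of_hasDerivAt_neg` — ONE-ZERO LEMMA: a function continuous on an open interval, all of whose zeros
  there carry a NEGATIVE derivative, has at most one zero in the interval (infimum argument). [folklore]
* §3 `hasDerivAt_critFirst`, `hasDerivAt_critSecond`, `hasDerivAt_indexForm` — raw `T`-derivatives of the two critical expressions and of the index form
  `𝒥 = 2S₁² − A S₂` along a branch `T ↦ (x, wⱼ) = (φ T, ω T)` (weights `w₀φ^{d₀}, wᵢφ^{dᵢ}, wₖφ^{dₖ}, ω·φ^{dⱼ}`), for ARBITRARY `φ, ω` differentiable at `T`.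
* §4 `linearised_critFirst`, `linearised_critSecond` — with `q = φ′/φ`, `ξ = ω′/ω` and the coupling `dₘ = c + λβₘ`, the vanishing of the raw derivatives
  is exactly the 2 × 2 system of `…FourFoldAlgebra.xiDeriv_identity`; `omegaDeriv_eq` packages the conclusion `ω′·(λ·Wⱼ·𝒟) = −2T·λ·𝒥·ω`.
* §5 `indexFormDeriv_eq_fold` — at a point where moreover `ω′ = 0`, the raw derivative of `𝒥` is the fold form of `…FourFoldAlgebra.indexFormDeriv_at_fold`
  and `q·λ·S₂ = −2S₁`; hence (`indexFormDeriv_eq_cubic`) `S₂²·𝒥′ = 2S₁·𝒞_W` there.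
[folklore] One-variable calculus (`HasDerivAt` algebra, slopes), order-completeness of `ℝ`.  No definitions, no named facts.
-/

-- `Summit.ValiantsHypothesis.ValiantsHypothesis.…` repeats a component by the D-0017 layout
-- (single-conjunct summit), which the `dupNamespace` linter flags; the name is mandated.
set_option linter.dupNamespace false

open Filter Topology Set

namespace Summit.ValiantsHypothesis.ValiantsHypothesis.Theorems.LacunarySymmetroidMatrixDescartes.Pivot.CriticalWindows.Four

/-! ## 1. The strict window at a four-letter critical point -/

/-- **STRICT WINDOW (four letters, lone letter `j` beyond the pivot).**  From the two critical equations with positive weights, `0 < tᵢ, tₖ < t₀ < T`: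
`T < tⱼ` and `bⱼ(T+t₀)(tⱼ−T) < a(T−t₀)(tⱼ+T)`. [folklore] -/
theorem window_of_critical_four {a bi bk bj t₀ ti tk tj T W₀ Wi Wk Wj : ℝ} (ha : 0 < a) (hbi : 0 < bi) (hbk : 0 < bk) (hbj : 0 < bj)
    (hWi : 0 < Wi) (hWk : 0 < Wk) (hWj : 0 < Wj) (hti : 0 < ti) (htk : 0 < tk) (htj : 0 < tj) (hi0 : ti < t₀)
    (hk0 : tk < t₀) (h0T : t₀ < T)
    (h1 : W₀ * (T ^ 2 - t₀ ^ 2) + Wi * (T ^ 2 - ti ^ 2) + Wk * (T ^ 2 - tk ^ 2) + Wj * (T ^ 2 - tj ^ 2) = 0)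
    (h2 : W₀ * (-a * (T - t₀) ^ 2) + Wi * (bi * (T - ti) ^ 2) + Wk * (bk * (T - tk) ^ 2) + Wj * (bj * (T - tj) ^ 2) = 0) :
    T < tj ∧ bj * (T + t₀) * (tj - T) < a * (T - t₀) * (tj + T) := by
  have hid : Wi * (T - ti) * (a * (T - t₀) * (T + ti) + bi * (T + t₀) * (T - ti))
      + Wk * (T - tk) * (a * (T - t₀) * (T + tk) + bk * (T + t₀) * (T - tk))
      + Wj * (T - tj) * (a * (T - t₀) * (T + tj) + bj * (T + t₀) * (T - tj)) = 0 := by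
    linear_combination (a * (T - t₀)) * h1 + (T + t₀) * h2
  have l0 : 0 < T - t₀ := by linarith
  have lp0 : 0 < T + t₀ := by linarith
  have pi : 0 < Wi * (T - ti) * (a * (T - t₀) * (T + ti) + bi * (T + t₀) * (T - ti)) := by
    have h3 : 0 < a * (T - t₀) * (T + ti) := mul_pos (mul_pos ha l0) (by linarith)
    have h4 : 0 < bi * (T + t₀) * (T - ti) := mul_pos (mul_pos hbi lp0) (by linarith)
    exact mul_pos (mul_pos hWi (by linarith)) (by linarith)
  have pk : 0 < Wk * (T - tk) * (a * (T - t₀) * (T + tk) + bk * (T + t₀) * (T - tk)) := by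
    have h3 : 0 < a * (T - t₀) * (T + tk) := mul_pos (mul_pos ha l0) (by linarith)
    have h4 : 0 < bk * (T + t₀) * (T - tk) := mul_pos (mul_pos hbk lp0) (by linarith)
    exact mul_pos (mul_pos hWk (by linarith)) (by linarith)
  have pj : Wj * (T - tj) * (a * (T - t₀) * (T + tj) + bj * (T + t₀) * (T - tj)) < 0 := by linarith
  have hTj : T < tj := by
    by_contra hcon
    push Not at hcon
    have h3 : 0 ≤ T - tj := by linarith
    have h5 : 0 < a * (T - t₀) * (T + tj) := mul_pos (mul_pos ha l0) (by linarith)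
    have h6 : 0 ≤ bj * (T + t₀) * (T - tj) := mul_nonneg (mul_pos hbj lp0).le h3
    have : 0 ≤ Wj * (T - tj) * (a * (T - t₀) * (T + tj) + bj * (T + t₀) * (T - tj)) :=
      mul_nonneg (mul_nonneg hWj.le h3) (by linarith)
    linarith
  refine ⟨hTj, ?_⟩
  have hneg : Wj * (T - tj) < 0 := mul_neg_of_pos_of_neg hWj (by linarith)
  have h4 : 0 < a * (T - t₀) * (T + tj) + bj * (T + t₀) * (T - tj) := by
    by_contra hcon
    push Not at hcon
    have : 0 ≤ Wj * (T - tj) * (a * (T - t₀) * (T + tj) + bj * (T + t₀) * (T - tj)) :=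
      mul_nonneg_of_nonpos_of_nonpos hneg.le hcon
    linarith
  have e : a * (T - t₀) * (tj + T) - bj * (T + t₀) * (tj - T) = a * (T - t₀) * (T + tj) + bj * (T + t₀) * (T - tj) := by ring
  linarith

/-! ## 2. The one-zero lemma -/

/-- At a zero with NEGATIVE derivative a function is positive just before and negative just after. [folklore] -/
theorem sign_near_zero_of_hasDerivAt_neg {f : ℝ → ℝ} {d z : ℝ} (hf : HasDerivAt f d z) (hd : d < 0) (hz : f z = 0) :
    ∃ ε > 0, (∀ y, z < y → y < z + ε → f y < 0) ∧ (∀ y, z - ε < y → y < z → 0 < f y) := by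
  rw [hasDerivAt_iff_tendsto_slope] at hf
  have hev : ∀ᶠ y in 𝓝[≠] z, slope f z y < 0 := hf (Iio_mem_nhds hd)
  rw [eventually_nhdsWithin_iff, Metric.eventually_nhds_iff] at hev
  obtain ⟨ε, hε, h⟩ := hev
  refine ⟨ε, hε, ?_, ?_⟩
  · intro y h1 h2
    have hy : dist y z < ε := by rw [Real.dist_eq, abs_lt]; constructor <;> linarith
    have hs := h hy (ne_of_gt h1)
    rw [slope_def_field, hz, sub_zero] at hs
    have : 0 < y - z := by linarith
    by_contra hcon
    push Not at hcon
    have : 0 ≤ f y / (y - z) := div_nonneg hcon this.le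
    linarith
  · intro y h1 h2
    have hy : dist y z < ε := by rw [Real.dist_eq, abs_lt]; constructor <;> linarith
    have hs := h hy (ne_of_lt h2)
    rw [slope_def_field, hz, sub_zero] at hs
    have hneg : y - z < 0 := by linarith
    by_contra hcon
    push Not at hcon
    have : 0 ≤ f y / (y - z) := div_nonneg_of_nonpos hcon hneg.le
    linarith

/-- **ONE-ZERO LEMMA.**  A function continuous on an open interval, each of whose zeros in the interval carries a negative derivative, has at most
one zero in the interval. [folklore] -/
theorem eq_of_zeros_of_hasDerivAt_neg {f f' : ℝ → ℝ} {α β : ℝ} (hc : ContinuousOn f (Ioo α β))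
    (hz : ∀ z ∈ Ioo α β, f z = 0 → HasDerivAt f (f' z) z ∧ f' z < 0)
    {z₁ z₂ : ℝ} (h1 : z₁ ∈ Ioo α β) (h2 : z₂ ∈ Ioo α β) (e1 : f z₁ = 0) (e2 : f z₂ = 0) : z₁ = z₂ := by
  by_contra hne
  wlog hlt : z₁ < z₂ generalizing z₁ z₂
  · exact this h2 h1 e2 e1 (Ne.symm hne) (lt_of_le_of_ne (not_lt.mp hlt) (Ne.symm hne))
  obtain ⟨d1, hd1⟩ := hz z₁ h1 e1
  obtain ⟨ε₁, hε₁, hR1, -⟩ := sign_near_zero_of_hasDerivAt_neg d1 hd1 e1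
  obtain ⟨d2, hd2⟩ := hz z₂ h2 e2
  obtain ⟨ε₂, hε₂, -, hL2⟩ := sign_near_zero_of_hasDerivAt_neg d2 hd2 e2
  set S : Set ℝ := {y | z₁ < y ∧ y < z₂ ∧ 0 < f y} with hS
  have hSne : S.Nonempty := by
    refine ⟨max (z₂ - ε₂ / 2) ((z₁ + z₂) / 2), ?_, ?_, ?_⟩
    · have : (z₁ + z₂) / 2 ≤ max (z₂ - ε₂ / 2) ((z₁ + z₂) / 2) := le_max_right _ _
      linarith
    · exact max_lt (by linarith) (by linarith)
    · apply hL2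
      · have : z₂ - ε₂ / 2 ≤ max (z₂ - ε₂ / 2) ((z₁ + z₂) / 2) := le_max_left _ _
        linarith
      · exact max_lt (by linarith) (by linarith)
  have hSbdd : BddBelow S := ⟨z₁, fun y hy => hy.1.le⟩
  set s := sInf S with hs
  have hs1 : z₁ ≤ s := le_csInf hSne (fun y hy => hy.1.le)
  have hs2 : s < z₂ := by
    obtain ⟨y, hy⟩ := hSne
    exact lt_of_le_of_lt (csInf_le hSbdd hy) hy.2.1
  have hs1' : z₁ < s := by
    by_contra hcon
    push Not at hcon
    have hseq : s = z₁ := le_antisymm hcon hs1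
    obtain ⟨y, hyS, hy⟩ := exists_lt_of_csInf_lt hSne (show s < z₁ + min ε₁ (z₂ - z₁) by
      rw [hseq]; have := lt_min hε₁ (sub_pos.mpr hlt); linarith)
    have : f y < 0 := hR1 y hyS.1 (by have := min_le_left ε₁ (z₂ - z₁); linarith)
    linarith [hyS.2.2]
  have hsI : s ∈ Ioo α β := ⟨lt_trans h1.1 hs1', lt_trans hs2 h2.2⟩
  have hfs_ge : 0 ≤ f s := by
    have hcs : ContinuousWithinAt f (Ioo α β) s := hc s hsI
    by_contra hcon
    push Not at hcon
    have hev : ∀ᶠ y in 𝓝[Ioo α β] s, f y < 0 := hcs.eventually (Iio_mem_nhds hcon)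
    rw [eventually_nhdsWithin_iff, Metric.eventually_nhds_iff] at hev
    obtain ⟨ε, hε, hεp⟩ := hev
    obtain ⟨y, hyS, hy⟩ := exists_lt_of_csInf_lt hSne (show s < s + ε by linarith)
    have hys : s ≤ y := csInf_le hSbdd hyS
    have : f y < 0 :=
      hεp (by rw [Real.dist_eq, abs_lt]; constructor <;> linarith) ⟨lt_trans h1.1 hyS.1, lt_trans hyS.2.1 h2.2⟩
    linarith [hyS.2.2]
  have hfs_le : f s ≤ 0 := by
    by_contra hcon
    push Not at hcon
    have hcs : ContinuousWithinAt f (Ioo α β) s := hc s hsI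
    have hev : ∀ᶠ y in 𝓝[Ioo α β] s, 0 < f y := hcs.eventually (Ioi_mem_nhds hcon)
    rw [eventually_nhdsWithin_iff, Metric.eventually_nhds_iff] at hev
    obtain ⟨ε, hε, hεp⟩ := hev
    set y := s - min (ε / 2) ((s - z₁) / 2) with hy
    have hmin : 0 < min (ε / 2) ((s - z₁) / 2) := lt_min (by linarith) (by linarith)
    have hy1 : z₁ < y := by have := min_le_right (ε / 2) ((s - z₁) / 2); rw [hy]; linarith
    have hy2 : y < s := by rw [hy]; linarith
    have hyI : y ∈ Ioo α β := ⟨lt_trans h1.1 hy1, lt_trans (lt_trans hy2 hs2) h2.2⟩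
    have hfy : 0 < f y :=
      hεp (by rw [Real.dist_eq, abs_lt]; have := min_le_left (ε / 2) ((s - z₁) / 2); constructor <;> linarith) hyI
    have := csInf_le hSbdd (show y ∈ S from ⟨hy1, lt_trans hy2 hs2, hfy⟩)
    linarith
  have hfs : f s = 0 := le_antisymm hfs_le hfs_ge
  obtain ⟨d3, hd3⟩ := hz s hsI hfs
  obtain ⟨ε₃, hε₃, -, hL3⟩ := sign_near_zero_of_hasDerivAt_neg d3 hd3 hfs
  set y := s - min (ε₃ / 2) ((s - z₁) / 2) with hy
  have hmin : 0 < min (ε₃ / 2) ((s - z₁) / 2) := lt_min (by linarith) (by linarith)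
  have hy1 : z₁ < y := by have := min_le_right (ε₃ / 2) ((s - z₁) / 2); rw [hy]; linarith
  have hy2 : y < s := by rw [hy]; linarith
  have hfy : 0 < f y := hL3 y (by have := min_le_left (ε₃ / 2) ((s - z₁) / 2); rw [hy]; linarith) hy2
  have := csInf_le hSbdd (show y ∈ S from ⟨hy1, lt_trans hy2 hs2, hfy⟩)
  linarith


/-! ## 3. Raw derivatives along a branch `T ↦ (φ T, ω T)` -/

/-- `d/dT (T² − t²) = 2T` and `d/dT (T − t)² = 2(T − t)`. [folklore] -/
theorem hasDerivAt_sq_sub (t T : ℝ) :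
    HasDerivAt (fun T' : ℝ => T' ^ 2 - t ^ 2) (2 * T) T ∧ HasDerivAt (fun T' : ℝ => (T' - t) ^ 2) (2 * (T - t)) T := by
  constructor
  · simpa using (hasDerivAt_pow 2 T).sub_const (t ^ 2)
  · have h := ((hasDerivAt_id T).sub_const t).fun_mul ((hasDerivAt_id T).sub_const t)
    have e : (fun T' : ℝ => (T' - t) ^ 2) = fun y => (y - t) * (y - t) := by funext y; ring
    rw [e]
    exact h.congr_deriv (by simp only [id]; ring)

/-- **RAW DERIVATIVE OF THE FIRST CRITICAL EXPRESSION** `∑ Wₘ(T² − tₘ²)` along a branch (`W₀ = w₀φ^{d₀}`, …, `Wⱼ = ω·φ^{dⱼ}`). [folklore] -/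
theorem hasDerivAt_critFirst {φ ω : ℝ → ℝ} {X XP O OP : ℝ} (w₀ wi wk t₀ ti tk tj T : ℝ) (d₀ di dk dj : ℕ)
    (hX : φ T = X) (hO : ω T = O) (hφ : HasDerivAt φ XP T) (hω : HasDerivAt ω OP T) :
    HasDerivAt (fun T' : ℝ => w₀ * φ T' ^ d₀ * (T' ^ 2 - t₀ ^ 2) + wi * φ T' ^ di * (T' ^ 2 - ti ^ 2) + wk * φ T' ^ dk * (T' ^ 2 - tk ^ 2) + ω T' * φ T' ^ dj * (T' ^ 2 - tj ^ 2))
      (((w₀ * ((d₀:ℝ) * X ^ (d₀ - 1) * XP)) * (T ^ 2 - t₀ ^ 2) + (w₀ * X ^ d₀) * (2 * T)) + ((wi * ((di:ℝ) * X ^ (di - 1) * XP)) * (T ^ 2 - ti ^ 2) + (wi * X ^ di) * (2 * T)) + ((wk * ((dk:ℝ) * X ^ (dk - 1) * XP)) * (T ^ 2 - tk ^ 2) + (wk * X ^ dk) * (2 * T)) + ((OP * X ^ dj + O * ((dj:ℝ) * X ^ (dj - 1) * XP)) * (T ^ 2 - tj ^ 2) + (O * X ^ dj) * (2 * T))) T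 := by
  subst hX hO
  obtain ⟨a0, -⟩ := hasDerivAt_sq_sub t₀ T
  obtain ⟨ai, -⟩ := hasDerivAt_sq_sub ti T
  obtain ⟨ak, -⟩ := hasDerivAt_sq_sub tk T
  obtain ⟨aj, -⟩ := hasDerivAt_sq_sub tj T
  have h0 := ((hφ.fun_pow d₀).const_mul w₀).fun_mul a0
  have hi := ((hφ.fun_pow di).const_mul wi).fun_mul ai
  have hk := ((hφ.fun_pow dk).const_mul wk).fun_mul ak
  have hj := (hω.fun_mul (hφ.fun_pow dj)).fun_mul aj
  exact (((h0.fun_add hi).fun_add hk).fun_add hj).congr_deriv (by ring)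

/-- **RAW DERIVATIVE OF THE SECOND CRITICAL EXPRESSION** `∑ βₘWₘ(T − tₘ)²` along a branch. [folklore] -/
theorem hasDerivAt_critSecond {φ ω : ℝ → ℝ} {X XP O OP : ℝ} (w₀ wi wk a bi bk bj t₀ ti tk tj T : ℝ) (d₀ di dk dj : ℕ)
    (hX : φ T = X) (hO : ω T = O) (hφ : HasDerivAt φ XP T) (hω : HasDerivAt ω OP T) :
    HasDerivAt (fun T' : ℝ => (-a) * (w₀ * φ T' ^ d₀) * (T' - t₀) ^ 2 + bi * (wi * φ T' ^ di) * (T' - ti) ^ 2 + bk * (wk * φ T' ^ dk) * (T' - tk) ^ 2 + bj * (ω T' * φ T' ^ dj) * (T' - tj) ^ 2)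
      (((-a) * (w₀ * ((d₀:ℝ) * X ^ (d₀ - 1) * XP)) * (T - t₀) ^ 2 + (-a) * (w₀ * X ^ d₀) * (2 * (T - t₀))) + (bi * (wi * ((di:ℝ) * X ^ (di - 1) * XP)) * (T - ti) ^ 2 + bi * (wi * X ^ di) * (2 * (T - ti))) + (bk * (wk * ((dk:ℝ) * X ^ (dk - 1) * XP)) * (T - tk) ^ 2 + bk * (wk * X ^ dk) * (2 * (T - tk))) + (bj * (OP * X ^ dj + O * ((dj:ℝ) * X ^ (dj - 1) * XP)) * (T - tj) ^ 2 + bj * (O * X ^ dj) * (2 * (T - tj)))) T := by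
  subst hX hO
  obtain ⟨-, u0⟩ := hasDerivAt_sq_sub t₀ T
  obtain ⟨-, ui⟩ := hasDerivAt_sq_sub ti T
  obtain ⟨-, uk⟩ := hasDerivAt_sq_sub tk T
  obtain ⟨-, uj⟩ := hasDerivAt_sq_sub tj T
  have h0 := (((hφ.fun_pow d₀).const_mul w₀).const_mul (-a)).fun_mul u0
  have hi := (((hφ.fun_pow di).const_mul wi).const_mul bi).fun_mul ui
  have hk := (((hφ.fun_pow dk).const_mul wk).const_mul bk).fun_mul uk
  have hj := ((hω.fun_mul (hφ.fun_pow dj)).const_mul bj).fun_mul uj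
  exact (((h0.fun_add hi).fun_add hk).fun_add hj).congr_deriv (by ring)

/-- **RAW DERIVATIVE OF THE INDEX FORM** `𝒥 = 2S₁² − A·S₂` along a branch. [folklore] -/
theorem hasDerivAt_indexForm {φ ω : ℝ → ℝ} {X XP O OP : ℝ} (w₀ wi wk a bi bk bj t₀ ti tk tj T : ℝ) (d₀ di dk dj : ℕ)
    (hX : φ T = X) (hO : ω T = O) (hφ : HasDerivAt φ XP T) (hω : HasDerivAt ω OP T) :
    HasDerivAt (fun T' : ℝ => 2 * ((-a) * (w₀ * φ T' ^ d₀) * (T' - t₀) + bi * (wi * φ T' ^ di) * (T' - ti) + bk * (wk * φ T' ^ dk) * (T' - tk) + bj * (ω T' * φ T' ^ dj) * (T' - tj)) ^ 2 - (w₀ * φ T' ^ d₀ + wi * φ T' ^ di + wk * φ T' ^ dk + ω T' * φ T' ^ dj) * ((-a) ^ 2 * (w₀ * φ T' ^ d₀) * (T' - t₀) ^ 2 + bi ^ 2 * (wi * φ T' ^ di) * (T' - ti) ^ 2 + bk ^ 2 * (wk * φ T' ^ dk) * (T' - tk) ^ 2 + bj ^ 2 * (ω T' * φ T' ^ dj)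 * (T' - tj) ^ 2))
      (2 * (2 * ((-a) * (w₀ * X ^ d₀) * (T - t₀) + bi * (wi * X ^ di) * (T - ti) + bk * (wk * X ^ dk) * (T - tk) + bj * (O * X ^ dj) * (T - tj)) * (((-a) * (w₀ * ((d₀:ℝ) * X ^ (d₀ - 1) * XP)) * (T - t₀) + (-a) * (w₀ * X ^ d₀)) + (bi * (wi * ((di:ℝ) * X ^ (di - 1) * XP)) * (T - ti) + bi * (wi * X ^ di)) + (bk * (wk * ((dk:ℝ) * X ^ (dk - 1) * XP)) * (T - tk) + bk * (wk * X ^ dk)) + (bj * (OP * X ^ dj + O * ((dj:ℝ) * X ^ (dj - 1) * XP)) * (T - tj) + bj * (O * X ^ dj)))) - (((w₀ * ((d₀:ℝ) * X ^ (d₀ - 1) * XP)) + (wi * ((di:ℝ) * X ^ (di - 1) * XP)) + (wk * ((dk:ℝ) * X ^ (dk - 1) * XP)) + (OP * X ^ dj + O * ((dj:ℝ) * X ^ (dj - 1) * XP))) * ((-a) ^ 2 * (w₀ * X ^ d₀) * (T - t₀) ^ 2 + bi ^ 2 * (wi * X ^ di) * (T - ti) ^ 2 + bk ^ 2 * (wk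 * X ^ dk) * (T - tk) ^ 2 + bj ^ 2 * (O * X ^ dj) * (T - tj) ^ 2) + ((w₀ * X ^ d₀) + (wi * X ^ di) + (wk * X ^ dk) + (O * X ^ dj)) * (((-a) ^ 2 * (w₀ * ((d₀:ℝ) * X ^ (d₀ - 1) * XP)) * (T - t₀) ^ 2 + (-a) ^ 2 * (w₀ * X ^ d₀) * (2 * (T - t₀))) + (bi ^ 2 * (wi * ((di:ℝ) * X ^ (di - 1) * XP)) * (T - ti) ^ 2 + bi ^ 2 * (wi * X ^ di) * (2 * (T - ti))) + (bk ^ 2 * (wk * ((dk:ℝ) * X ^ (dk - 1) * XP)) * (T - tk) ^ 2 + bk ^ 2 * (wk * X ^ dk) * (2 * (T - tk))) + (bj ^ 2 * (OP * X ^ dj + O * ((dj:ℝ) * X ^ (dj - 1) * XP)) * (T - tj) ^ 2 + bj ^ 2 * (O * X ^ dj) * (2 * (T - tj)))))) T := by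
  subst hX hO
  obtain ⟨-, u0⟩ := hasDerivAt_sq_sub t₀ T
  obtain ⟨-, ui⟩ := hasDerivAt_sq_sub ti T
  obtain ⟨-, uk⟩ := hasDerivAt_sq_sub tk T
  obtain ⟨-, uj⟩ := hasDerivAt_sq_sub tj T
  have W0 := (hφ.fun_pow d₀).const_mul w₀
  have Wi := (hφ.fun_pow di).const_mul wi
  have Wk := (hφ.fun_pow dk).const_mul wk
  have Wj := hω.mul (hφ.fun_pow dj)
  -- S₁
  have s0 := (W0.const_mul (-a)).fun_mul ((hasDerivAt_id T).sub_const t₀)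
  have si := (Wi.const_mul bi).fun_mul ((hasDerivAt_id T).sub_const ti)
  have sk := (Wk.const_mul bk).fun_mul ((hasDerivAt_id T).sub_const tk)
  have sj := (Wj.const_mul bj).fun_mul ((hasDerivAt_id T).sub_const tj)
  have hS1 := ((s0.fun_add si).fun_add sk).fun_add sj
  -- S₂
  have q0 := (W0.const_mul ((-a) ^ 2)).fun_mul u0
  have qi := (Wi.const_mul (bi ^ 2)).fun_mul ui
  have qk := (Wk.const_mul (bk ^ 2)).fun_mul uk
  have qj := (Wj.const_mul (bj ^ 2)).fun_mul uj
  have hS2 := ((q0.fun_add qi).fun_add qk).fun_add qj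
  -- A
  have hA := ((W0.fun_add Wi).fun_add Wk).fun_add Wj
  have hJ := ((hS1.fun_pow 2).const_mul 2).fun_sub (hA.fun_mul hS2)
  exact hJ.congr_deriv (by simp only [id]; norm_num)


/-! ## 4. The linearised critical equations and the derivative of the required weight -/

/-- `w·(d·X^{d−1}·X′) = d·(w X^d)·(X′/X)` for `X ≠ 0`. [folklore] -/
theorem weightDeriv_eq (w X XP : ℝ) (d : ℕ) (hX : X ≠ 0) :
    w * ((d : ℝ) * X ^ (d - 1) * XP) = (d : ℝ) * (w * X ^ d) * (XP / X) := by
  have e := SecularRolle.mul_natCast_mul_pow_pred X d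
  field_simp
  linear_combination (w * XP) * e

/-- **LINEARISED FIRST EQUATION.**  If the raw derivative of `∑Wₘ(T²−tₘ²)` vanishes, `φ T = X ≠ 0`, `ω T = O ≠ 0`, and `dₘ = c + λβₘ`, then with `q = X′/X`,
`ξ = O′/O`: `(∑dₘWₘAₘ)·q + WⱼAⱼ·ξ = −2T·∑Wₘ` in the format of `xiDeriv_identity`. [folklore] -/
theorem linearised_critFirst {X XP O OP w₀ wi wk a bi bk bj t₀ ti tk tj T c lam : ℝ} {d₀ di dk dj : ℕ}
    (hX : X ≠ 0) (hO : O ≠ 0)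
    (hd₀ : (d₀ : ℝ) = c + lam * (-a)) (hdi : (di : ℝ) = c + lam * bi) (hdk : (dk : ℝ) = c + lam * bk) (hdj : (dj : ℝ) = c + lam * bj)
    (hraw : ((w₀ * ((d₀:ℝ) * X ^ (d₀ - 1) * XP)) * (T ^ 2 - t₀ ^ 2) + (w₀ * X ^ d₀) * (2 * T)) + ((wi * ((di:ℝ) * X ^ (di - 1) * XP)) * (T ^ 2 - ti ^ 2) + (wi * X ^ di) * (2 * T)) + ((wk * ((dk:ℝ) * X ^ (dk - 1) * XP)) * (T ^ 2 - tk ^ 2) + (wk * X ^ dk) * (2 * T)) + ((OP * X ^ dj + O * ((dj:ℝ) * X ^ (dj - 1) * XP)) * (T ^ 2 - tj ^ 2) + (O * X ^ dj) * (2 * T)) = 0) :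
    ((c + lam * (-a)) * (w₀ * X ^ d₀) * (T ^ 2 - t₀ ^ 2) + (c + lam * bi) * (wi * X ^ di) * (T ^ 2 - ti ^ 2) + (c + lam * bk) * (wk * X ^ dk) * (T ^ 2 - tk ^ 2) + (c + lam * bj) * (O * X ^ dj) * (T ^ 2 - tj ^ 2)) * (XP / X) + ((O * X ^ dj) * (T ^ 2 - tj ^ 2)) * (OP / O) = -(2 * T) * ((w₀ * X ^ d₀) + (wi * X ^ di) + (wk * X ^ dk) + (O * X ^ dj)) := by
  have e0 := weightDeriv_eq w₀ X XP d₀ hX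
  have ei := weightDeriv_eq wi X XP di hX
  have ek := weightDeriv_eq wk X XP dk hX
  have ej := weightDeriv_eq O X XP dj hX
  have eO : OP * X ^ dj = (O * X ^ dj) * (OP / O) := by field_simp
  linear_combination hraw - (T ^ 2 - t₀ ^ 2) * e0 - (T ^ 2 - ti ^ 2) * ei - (T ^ 2 - tk ^ 2) * ek - (T ^ 2 - tj ^ 2) * ej
    - ((w₀ * X ^ d₀) * (T ^ 2 - t₀ ^ 2) * (XP / X)) * hd₀ - ((wi * X ^ di) * (T ^ 2 - ti ^ 2) * (XP / X)) * hdi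
    - ((wk * X ^ dk) * (T ^ 2 - tk ^ 2) * (XP / X)) * hdk - ((O * X ^ dj) * (T ^ 2 - tj ^ 2) * (XP / X)) * hdj
    - (T ^ 2 - tj ^ 2) * eO

/-- **LINEARISED SECOND EQUATION.**  Same for `∑βₘWₘ(T−tₘ)²`: `(∑βₘdₘWₘuₘ²)·q + bⱼWⱼuⱼ²·ξ = −2·S₁`. [folklore] -/
theorem linearised_critSecond {X XP O OP w₀ wi wk a bi bk bj t₀ ti tk tj T c lam : ℝ} {d₀ di dk dj : ℕ}
    (hX : X ≠ 0) (hO : O ≠ 0)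
    (hd₀ : (d₀ : ℝ) = c + lam * (-a)) (hdi : (di : ℝ) = c + lam * bi) (hdk : (dk : ℝ) = c + lam * bk) (hdj : (dj : ℝ) = c + lam * bj)
    (hraw : ((-a) * (w₀ * ((d₀:ℝ) * X ^ (d₀ - 1) * XP)) * (T - t₀) ^ 2 + (-a) * (w₀ * X ^ d₀) * (2 * (T - t₀))) + (bi * (wi * ((di:ℝ) * X ^ (di - 1) * XP)) * (T - ti) ^ 2 + bi * (wi * X ^ di) * (2 * (T - ti))) + (bk * (wk * ((dk:ℝ) * X ^ (dk - 1) * XP)) * (T - tk) ^ 2 + bk * (wk * X ^ dk) * (2 * (T - tk))) + (bj * (OP * X ^ dj + O * ((dj:ℝ) * X ^ (dj - 1) * XP)) * (T - tj) ^ 2 + bj * (O * X ^ dj) * (2 * (T - tj))) = 0) :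
    ((-a) * (c + lam * (-a)) * (w₀ * X ^ d₀) * (T - t₀) ^ 2 + bi * (c + lam * bi) * (wi * X ^ di) * (T - ti) ^ 2 + bk * (c + lam * bk) * (wk * X ^ dk) * (T - tk) ^ 2 + bj * (c + lam * bj) * (O * X ^ dj) * (T - tj) ^ 2) * (XP / X) + (bj * (O * X ^ dj) * (T - tj) ^ 2) * (OP / O) = -2 * ((-a) * (w₀ * X ^ d₀) * (T - t₀) + bi * (wi * X ^ di) * (T - ti) + bk * (wk * X ^ dk) * (T - tk) + bj * (O * X ^ dj) * (T - tj)) := by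
  have e0 := weightDeriv_eq w₀ X XP d₀ hX
  have ei := weightDeriv_eq wi X XP di hX
  have ek := weightDeriv_eq wk X XP dk hX
  have ej := weightDeriv_eq O X XP dj hX
  have eO : OP * X ^ dj = (O * X ^ dj) * (OP / O) := by field_simp
  linear_combination hraw - ((-a) * (T - t₀) ^ 2) * e0 - (bi * (T - ti) ^ 2) * ei - (bk * (T - tk) ^ 2) * ek - (bj * (T - tj) ^ 2) * ej
    - ((-a) * (w₀ * X ^ d₀) * (T - t₀) ^ 2 * (XP / X)) * hd₀ - (bi * (wi * X ^ di) * (T - ti) ^ 2 * (XP / X)) * hdi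
    - (bk * (wk * X ^ dk) * (T - tk) ^ 2 * (XP / X)) * hdk - (bj * (O * X ^ dj) * (T - tj) ^ 2 * (XP / X)) * hdj
    - (bj * (T - tj) ^ 2) * eO

/-- **THE DERIVATIVE OF THE REQUIRED WEIGHT.**  Along a branch on which both critical expressions vanish identically (so their raw derivatives vanish at `T`)
and at which the two critical equations hold, with `φ T = X ≠ 0`, `ω T = O ≠ 0`, `dₘ = c + λβₘ`:
`O′·(λ·Wⱼ·𝒟) = −2T·λ·𝒥·O` (`Wⱼ = O·X^{dⱼ}`; `𝒟`, `𝒥` as in `…FourFoldAlgebra`). [folklore] -/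
theorem omegaDeriv_eq {X XP O OP w₀ wi wk a bi bk bj t₀ ti tk tj T c lam : ℝ} {d₀ di dk dj : ℕ}
    (hX : X ≠ 0) (hO : O ≠ 0)
    (hd₀ : (d₀ : ℝ) = c + lam * (-a)) (hdi : (di : ℝ) = c + lam * bi) (hdk : (dk : ℝ) = c + lam * bk) (hdj : (dj : ℝ) = c + lam * bj)
    (h1 : (w₀ * X ^ d₀) * (T ^ 2 - t₀ ^ 2) + (wi * X ^ di) * (T ^ 2 - ti ^ 2) + (wk * X ^ dk) * (T ^ 2 - tk ^ 2) + (O * X ^ dj) * (T ^ 2 - tj ^ 2) = 0)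
    (h2 : (-a) * (w₀ * X ^ d₀) * (T - t₀) ^ 2 + bi * (wi * X ^ di) * (T - ti) ^ 2 + bk * (wk * X ^ dk) * (T - tk) ^ 2 + bj * (O * X ^ dj) * (T - tj) ^ 2 = 0)
    (hraw1 : ((w₀ * ((d₀:ℝ) * X ^ (d₀ - 1) * XP)) * (T ^ 2 - t₀ ^ 2) + (w₀ * X ^ d₀) * (2 * T)) + ((wi * ((di:ℝ) * X ^ (di - 1) * XP)) * (T ^ 2 - ti ^ 2) + (wi * X ^ di) * (2 * T)) + ((wk * ((dk:ℝ) * X ^ (dk - 1) * XP)) * (T ^ 2 - tk ^ 2) + (wk * X ^ dk) * (2 * T)) + ((OP * X ^ dj + O * ((dj:ℝ) * X ^ (dj - 1) * XP)) * (T ^ 2 - tj ^ 2) + (O * X ^ dj) * (2 * T)) = 0)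
    (hraw2 : ((-a) * (w₀ * ((d₀:ℝ) * X ^ (d₀ - 1) * XP)) * (T - t₀) ^ 2 + (-a) * (w₀ * X ^ d₀) * (2 * (T - t₀))) + (bi * (wi * ((di:ℝ) * X ^ (di - 1) * XP)) * (T - ti) ^ 2 + bi * (wi * X ^ di) * (2 * (T - ti))) + (bk * (wk * ((dk:ℝ) * X ^ (dk - 1) * XP)) * (T - tk) ^ 2 + bk * (wk * X ^ dk) * (2 * (T - tk))) + (bj * (OP * X ^ dj + O * ((dj:ℝ) * X ^ (dj - 1) * XP)) * (T - tj) ^ 2 + bj * (O * X ^ dj) * (2 * (T - tj))) = 0) :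
    OP * (lam * (O * X ^ dj) * (bj * (T - tj) ^ 2 * ((-a) * (w₀ * X ^ d₀) * (T ^ 2 - t₀ ^ 2) + bi * (wi * X ^ di) * (T ^ 2 - ti ^ 2) + bk * (wk * X ^ dk) * (T ^ 2 - tk ^ 2) + bj * (O * X ^ dj) * (T ^ 2 - tj ^ 2)) + (tj ^ 2 - T ^ 2) * ((-a) ^ 2 * (w₀ * X ^ d₀) * (T - t₀) ^ 2 + bi ^ 2 * (wi * X ^ di) * (T - ti) ^ 2 + bk ^ 2 * (wk * X ^ dk) * (T - tk) ^ 2 + bj ^ 2 * (O * X ^ dj) * (T - tj) ^ 2))) = -(2 * T) * lam * (2 * ((-a) * (w₀ * X ^ d₀) * (T - t₀) + bi * (wi * X ^ di) * (T - ti) + bk * (wk * X ^ dk) * (T - tk) + bj * (O * X ^ dj) * (T - tj)) ^ 2 - ((w₀ * X ^ d₀) + (wi * X ^ di) + (wk * X ^ dk) + (O * X ^ dj)) * ((-a) ^ 2 * (w₀ * X ^ d₀) * (T - t₀) ^ 2 + bi ^ 2 * (wi * X ^ di) * (T - ti) ^ 2 + bk ^ 2 * (wk * X ^ dk) * (T -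 tk) ^ 2 + bj ^ 2 * (O * X ^ dj) * (T - tj) ^ 2)) * O := by
  have l1 := linearised_critFirst hX hO hd₀ hdi hdk hdj hraw1
  have l2 := linearised_critSecond hX hO hd₀ hdi hdk hdj hraw2
  have hx := xiDeriv_identity (w₀ * X ^ d₀) (wi * X ^ di) (wk * X ^ dk) (O * X ^ dj) a bi bk bj t₀ ti tk tj T c lam (XP / X) (OP / O)
    h1 h2 l1 l2
  have e : OP = (OP / O) * O := by field_simp
  rw [e]
  linear_combination O * hx


/-! ## 5. The derivative of the index form at a critical point of the required weight -/

/-- **(-a) * (c + lam * (-a)) * (w₀ * X ^ d₀) * (T - t₀) ^ 2 + bi * (c + lam * bi) * (wi * X ^ di) * (T - ti) ^ 2 + bk * (c + lam * bk) * (wk * X ^ dk) * (T - tk) ^ 2 + bj * (c + lam * bj) * (O * X ^ dj) * (T - tj) ^ 2W `𝒥′` = FOLD FORM when `ω′ = 0`.**  With `O′ = 0`, `X ≠ 0` and `dₘ = c + λβₘ`, the raw derivative of `𝒥` equals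
`4S₁(q(cS₁+λB₂) + B₀) − q(cA+λB₀)S₂ − A(q(cS₂+λB₃) + 2B₂)` with `q = X′/X`. [folklore] -/
theorem indexFormDeriv_eq_fold {X XP O w₀ wi wk a bi bk bj t₀ ti tk tj T c lam : ℝ} {d₀ di dk dj : ℕ}
    (hX : X ≠ 0)
    (hd₀ : (d₀ : ℝ) = c + lam * (-a)) (hdi : (di : ℝ) = c + lam * bi) (hdk : (dk : ℝ) = c + lam * bk) (hdj : (dj : ℝ) = c + lam * bj) :
    2 * (2 * ((-a) * (w₀ * X ^ d₀) * (T - t₀) + bi * (wi * X ^ di) * (T - ti) + bk * (wk * X ^ dk) * (T - tk) + bj * (O * X ^ dj) * (T - tj)) * (((-a) * (w₀ * ((d₀:ℝ) * X ^ (d₀ - 1) * XP)) * (T - t₀) + (-a) * (w₀ * X ^ d₀)) + (bi * (wi * ((di:ℝ) * X ^ (di - 1) * XP)) * (T - ti) + bi * (wi * X ^ di)) + (bk * (wk * ((dk:ℝ) * X ^ (dk - 1) * XP)) * (T - tk) + bk * (wk * X ^ dk)) + (bj * (0 * X ^ dj + O * ((dj:ℝ) * X ^ (dj - 1) * XP))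 * (T - tj) + bj * (O * X ^ dj)))) - (((w₀ * ((d₀:ℝ) * X ^ (d₀ - 1) * XP)) + (wi * ((di:ℝ) * X ^ (di - 1) * XP)) + (wk * ((dk:ℝ) * X ^ (dk - 1) * XP)) + (0 * X ^ dj + O * ((dj:ℝ) * X ^ (dj - 1) * XP))) * ((-a) ^ 2 * (w₀ * X ^ d₀) * (T - t₀) ^ 2 + bi ^ 2 * (wi * X ^ di) * (T - ti) ^ 2 + bk ^ 2 * (wk * X ^ dk) * (T - tk) ^ 2 + bj ^ 2 * (O * X ^ dj) * (T - tj) ^ 2) + ((w₀ * X ^ d₀) + (wi * X ^ di) + (wk * X ^ dk) + (O * X ^ dj)) * (((-a) ^ 2 * (w₀ * ((d₀:ℝ) * X ^ (d₀ - 1) * XP)) * (T - t₀) ^ 2 + (-a) ^ 2 * (w₀ * X ^ d₀) * (2 * (T - t₀))) + (bi ^ 2 * (wi * ((di:ℝ) * X ^ (di - 1) * XP)) * (T - ti) ^ 2 + bi ^ 2 * (wi * X ^ di) * (2 * (T - ti))) + (bk ^ 2 * (wk * ((dk:ℝ) * X ^ (dk - 1) * XP)) * (T - tk) ^ 2 +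 bk ^ 2 * (wk * X ^ dk) * (2 * (T - tk))) + (bj ^ 2 * (0 * X ^ dj + O * ((dj:ℝ) * X ^ (dj - 1) * XP)) * (T - tj) ^ 2 + bj ^ 2 * (O * X ^ dj) * (2 * (T - tj))))) = (4 * ((-a) * (w₀ * X ^ d₀) * (T - t₀) + bi * (wi * X ^ di) * (T - ti) + bk * (wk * X ^ dk) * (T - tk) + bj * (O * X ^ dj) * (T - tj)) * ((XP / X) * (c * ((-a) * (w₀ * X ^ d₀) * (T - t₀) + bi * (wi * X ^ di) * (T - ti) + bk * (wk * X ^ dk) * (T - tk) + bj * (O * X ^ dj) * (T - tj)) + lam * ((-a) ^ 2 * (w₀ * X ^ d₀) * (T - t₀) + bi ^ 2 * (wi * X ^ di) * (T - ti) + bk ^ 2 * (wk * X ^ dk) * (T - tk) + bj ^ 2 * (O * X ^ dj) * (T - tj))) + ((-a) * (w₀ * X ^ d₀) + bi * (wi * X ^ di) + bk * (wk * X ^ dk) + bj * (O * X ^ dj))) - (XP / X) * (c * ((w₀ * X ^ d₀) + (wi * X ^ di) + (wk * X ^ dk) + (O * X ^ dj)) + lam * ((-a) * (w₀ * X ^ d₀)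 + bi * (wi * X ^ di) + bk * (wk * X ^ dk) + bj * (O * X ^ dj))) * ((-a) ^ 2 * (w₀ * X ^ d₀) * (T - t₀) ^ 2 + bi ^ 2 * (wi * X ^ di) * (T - ti) ^ 2 + bk ^ 2 * (wk * X ^ dk) * (T - tk) ^ 2 + bj ^ 2 * (O * X ^ dj) * (T - tj) ^ 2) - ((w₀ * X ^ d₀) + (wi * X ^ di) + (wk * X ^ dk) + (O * X ^ dj)) * ((XP / X) * (c * ((-a) ^ 2 * (w₀ * X ^ d₀) * (T - t₀) ^ 2 + bi ^ 2 * (wi * X ^ di) * (T - ti) ^ 2 + bk ^ 2 * (wk * X ^ dk) * (T - tk) ^ 2 + bj ^ 2 * (O * X ^ dj) * (T - tj) ^ 2) + lam * ((-a) ^ 3 * (w₀ * X ^ d₀) * (T - t₀) ^ 2 + bi ^ 3 * (wi * X ^ di) * (T - ti) ^ 2 + bk ^ 3 * (wk * X ^ dk) * (T - tk) ^ 2 + bj ^ 3 * (O * X ^ dj) * (T - tj) ^ 2)) + 2 * ((-a) ^ 2 * (w₀ * X ^ d₀) * (T - t₀) + bi ^ 2 * (wi * X ^ di) * (T - ti)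 + bk ^ 2 * (wk * X ^ dk) * (T - tk) + bj ^ 2 * (O * X ^ dj) * (T - tj)))) := by
  have e0 := weightDeriv_eq w₀ X XP d₀ hX
  have ei := weightDeriv_eq wi X XP di hX
  have ek := weightDeriv_eq wk X XP dk hX
  have ej := weightDeriv_eq O X XP dj hX
  rw [e0, ei, ek, ej, hd₀, hdi, hdk, hdj]
  ring

/-- **`S₂²·𝒥′ = 2S₁·𝒞_W` AT A CRITICAL POINT OF THE REQUIRED WEIGHT.**  If moreover the raw derivative of the second critical expression vanishes
(with `O′ = 0`), the second critical equation holds, `𝒥 = 0`, `S₂ ≠ 0` and `λ ≠ 0`, then `S₂²·𝒥′ = 2S₁·𝒞_W`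
(`…FourFoldAlgebra.indexFormDeriv_at_fold_four`). [folklore] -/
theorem indexFormDeriv_eq_cubic {X XP O w₀ wi wk a bi bk bj t₀ ti tk tj T c lam : ℝ} {d₀ di dk dj : ℕ}
    (hX : X ≠ 0) (hO : O ≠ 0) (hlam : lam ≠ 0)
    (hd₀ : (d₀ : ℝ) = c + lam * (-a)) (hdi : (di : ℝ) = c + lam * bi) (hdk : (dk : ℝ) = c + lam * bk) (hdj : (dj : ℝ) = c + lam * bj)
    (hS₂ : ((-a) ^ 2 * (w₀ * X ^ d₀) * (T - t₀) ^ 2 + bi ^ 2 * (wi * X ^ di) * (T - ti) ^ 2 + bk ^ 2 * (wk * X ^ dk) * (T - tk) ^ 2 + bj ^ 2 * (O * X ^ dj) * (T - tj) ^ 2) ≠ 0)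
    (h2 : (-a) * (w₀ * X ^ d₀) * (T - t₀) ^ 2 + bi * (wi * X ^ di) * (T - ti) ^ 2 + bk * (wk * X ^ dk) * (T - tk) ^ 2 + bj * (O * X ^ dj) * (T - tj) ^ 2 = 0)
    (hraw2 : ((-a) * (w₀ * ((d₀:ℝ) * X ^ (d₀ - 1) * XP)) * (T - t₀) ^ 2 + (-a) * (w₀ * X ^ d₀) * (2 * (T - t₀))) + (bi * (wi * ((di:ℝ) * X ^ (di - 1) * XP)) * (T - ti) ^ 2 + bi * (wi * X ^ di) * (2 * (T - ti))) + (bk * (wk * ((dk:ℝ) * X ^ (dk - 1) * XP)) * (T - tk) ^ 2 + bk * (wk * X ^ dk) * (2 * (T - tk))) + (bj * (0 * X ^ dj + O * ((dj:ℝ) * X ^ (dj - 1) * XP)) * (T - tj) ^ 2 + bj * (O * X ^ dj) * (2 * (T - tj))) = 0)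
    (hfold : ((w₀ * X ^ d₀) + (wi * X ^ di) + (wk * X ^ dk) + (O * X ^ dj)) * ((-a) ^ 2 * (w₀ * X ^ d₀) * (T - t₀) ^ 2 + bi ^ 2 * (wi * X ^ di) * (T - ti) ^ 2 + bk ^ 2 * (wk * X ^ dk) * (T - tk) ^ 2 + bj ^ 2 * (O * X ^ dj) * (T - tj) ^ 2) = 2 * ((-a) * (w₀ * X ^ d₀) * (T - t₀) + bi * (wi * X ^ di) * (T - ti) + bk * (wk * X ^ dk) * (T - tk) + bj * (O * X ^ dj) * (T - tj)) ^ 2) :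
    ((-a) ^ 2 * (w₀ * X ^ d₀) * (T - t₀) ^ 2 + bi ^ 2 * (wi * X ^ di) * (T - ti) ^ 2 + bk ^ 2 * (wk * X ^ dk) * (T - tk) ^ 2 + bj ^ 2 * (O * X ^ dj) * (T - tj) ^ 2) ^ 2 * (2 * (2 * ((-a) * (w₀ * X ^ d₀) * (T - t₀) + bi * (wi * X ^ di) * (T - ti) + bk * (wk * X ^ dk) * (T - tk) + bj * (O * X ^ dj) * (T - tj)) * (((-a) * (w₀ * ((d₀:ℝ) * X ^ (d₀ - 1) * XP)) * (T - t₀) + (-a) * (w₀ * X ^ d₀)) + (bi * (wi * ((di:ℝ) * X ^ (di - 1) * XP)) * (T - ti) + bi * (wi * X ^ di)) + (bk * (wk * ((dk:ℝ) * X ^ (dk - 1) * XP)) * (T - tk) + bk * (wk * X ^ dk)) + (bj * (0 * X ^ dj + O * ((dj:ℝ) * X ^ (dj - 1) * XP)) * (T - tj) + bj * (O * X ^ dj)))) - (((w₀ * ((d₀:ℝ) * X ^ (d₀ - 1) * XP)) + (wi * ((di:ℝ) * X ^ (di - 1) * XP)) + (wk * ((dk:ℝ) * X ^ (dk - 1)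 * XP)) + (0 * X ^ dj + O * ((dj:ℝ) * X ^ (dj - 1) * XP))) * ((-a) ^ 2 * (w₀ * X ^ d₀) * (T - t₀) ^ 2 + bi ^ 2 * (wi * X ^ di) * (T - ti) ^ 2 + bk ^ 2 * (wk * X ^ dk) * (T - tk) ^ 2 + bj ^ 2 * (O * X ^ dj) * (T - tj) ^ 2) + ((w₀ * X ^ d₀) + (wi * X ^ di) + (wk * X ^ dk) + (O * X ^ dj)) * (((-a) ^ 2 * (w₀ * ((d₀:ℝ) * X ^ (d₀ - 1) * XP)) * (T - t₀) ^ 2 + (-a) ^ 2 * (w₀ * X ^ d₀) * (2 * (T - t₀))) + (bi ^ 2 * (wi * ((di:ℝ) * X ^ (di - 1) * XP)) * (T - ti) ^ 2 + bi ^ 2 * (wi * X ^ di) * (2 * (T - ti))) + (bk ^ 2 * (wk * ((dk:ℝ) * X ^ (dk - 1) * XP)) * (T - tk) ^ 2 + bk ^ 2 * (wk * X ^ dk) * (2 * (T - tk))) + (bj ^ 2 * (0 * X ^ dj + O * ((dj:ℝ) * X ^ (dj - 1) * XP)) * (T - tj) ^ 2 + bj ^ 2 * (O * X ^ dj) * (2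 * (T - tj)))))) = 2 * ((-a) * (w₀ * X ^ d₀) * (T - t₀) + bi * (wi * X ^ di) * (T - ti) + bk * (wk * X ^ dk) * (T - tk) + bj * (O * X ^ dj) * (T - tj)) * (3 * ((-a) * (w₀ * X ^ d₀) + bi * (wi * X ^ di) + bk * (wk * X ^ dk) + bj * (O * X ^ dj)) * ((-a) ^ 2 * (w₀ * X ^ d₀) * (T - t₀) ^ 2 + bi ^ 2 * (wi * X ^ di) * (T - ti) ^ 2 + bk ^ 2 * (wk * X ^ dk) * (T - tk) ^ 2 + bj ^ 2 * (O * X ^ dj) * (T - tj) ^ 2) ^ 2 - 6 * ((-a) ^ 2 * (w₀ * X ^ d₀) * (T - t₀) + bi ^ 2 * (wi * X ^ di) * (T - ti) + bk ^ 2 * (wk * X ^ dk) * (T - tk) + bj ^ 2 * (O * X ^ dj) * (T - tj)) * ((-a) * (w₀ * X ^ d₀) * (T - t₀) + bi * (wi * X ^ di) * (T - ti) + bk * (wk * X ^ dk) * (T - tk) + bj * (O * X ^ dj) * (T - tj)) * ((-a) ^ 2 * (w₀ * X ^ d₀) * (T - t₀) ^ 2 + bi ^ 2 * (wi * X ^ di)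 * (T - ti) ^ 2 + bk ^ 2 * (wk * X ^ dk) * (T - tk) ^ 2 + bj ^ 2 * (O * X ^ dj) * (T - tj) ^ 2) + 2 * ((-a) ^ 3 * (w₀ * X ^ d₀) * (T - t₀) ^ 2 + bi ^ 3 * (wi * X ^ di) * (T - ti) ^ 2 + bk ^ 3 * (wk * X ^ dk) * (T - tk) ^ 2 + bj ^ 3 * (O * X ^ dj) * (T - tj) ^ 2) * ((-a) * (w₀ * X ^ d₀) * (T - t₀) + bi * (wi * X ^ di) * (T - ti) + bk * (wk * X ^ dk) * (T - tk) + bj * (O * X ^ dj) * (T - tj)) ^ 2) := by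
  rw [indexFormDeriv_eq_fold (O := O) (w₀ := w₀) (wi := wi) (wk := wk) (bi := bi) (bk := bk) (bj := bj) (t₀ := t₀) (ti := ti) (tk := tk)
    (tj := tj) (T := T) hX hd₀ hdi hdk hdj]
  have l2 := linearised_critSecond (OP := 0) hX hO hd₀ hdi hdk hdj hraw2
  obtain ⟨-, hR, -, -, -, -⟩ := coupled_sums (w₀ * X ^ d₀) (wi * X ^ di) (wk * X ^ dk) (O * X ^ dj) a bi bk bj t₀ ti tk tj T c lam
  have hq : (XP / X) * (lam * ((-a) ^ 2 * (w₀ * X ^ d₀) * (T - t₀) ^ 2 + bi ^ 2 * (wi * X ^ di) * (T - ti) ^ 2 + bk ^ 2 * (wk * X ^ dk) * (T - tk) ^ 2 + bj ^ 2 * (O * X ^ dj) * (T - tj) ^ 2)) = -2 * ((-a) * (w₀ * X ^ d₀) * (T - t₀) + bi * (wi * X ^ di) * (T - ti) + bk * (wk * X ^ dk) * (T - tk) + bj * (O * X ^ dj) * (T - tj)) := by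
    have : ((-a) * (c + lam * (-a)) * (w₀ * X ^ d₀) * (T - t₀) ^ 2 + bi * (c + lam * bi) * (wi * X ^ di) * (T - ti) ^ 2 + bk * (c + lam * bk) * (wk * X ^ dk) * (T - tk) ^ 2 + bj * (c + lam * bj) * (O * X ^ dj) * (T - tj) ^ 2) = lam * ((-a) ^ 2 * (w₀ * X ^ d₀) * (T - t₀) ^ 2 + bi ^ 2 * (wi * X ^ di) * (T - ti) ^ 2 + bk ^ 2 * (wk * X ^ dk) * (T - tk) ^ 2 + bj ^ 2 * (O * X ^ dj) * (T - tj) ^ 2) := by rw [hR, h2]; ring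
    rw [← this]
    linear_combination l2
  exact indexFormDeriv_at_fold_four (w₀ * X ^ d₀) (wi * X ^ di) (wk * X ^ dk) (O * X ^ dj) a bi bk bj t₀ ti tk tj T c lam (XP / X)
    hS₂ hlam hq hfold


end Summit.ValiantsHypothesis.ValiantsHypothesis.Theorems.LacunarySymmetroidMatrixDescartes.Pivot.CriticalWindows.Four
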